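import Mathlib.Analysis.SpecialFunctions.Gaussian.GaussianIntegral
import Mathlib.Analysis.SpecialFunctions.Gamma.Basic
import Literature.MathematicalPhysics.StatisticalMechanics.Crystallization
import HarnessLib

/-!
# One-crossing Gaussian mixtures ("class 1" pair potentials) and the Lennard-Jones density

Topic `MathematicalPhysics/StatisticalMechanics`; namespace
`Literature.MathematicalPhysics.StatisticalMechanics`. Definition request `defn-IsOneCrossingMixture`
of route `Summits/AtomisticToContinuum/Crystallization/Theses/OneSignChangeClass` (items
stmt-AtomisticToContinuum-4041 – 4047 carry the notion inline; this file names it, verbatim).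

A radial pair potential `V : ℝ → ℝ` (a function of the distance `r > 0`) is a **one-crossing
Gaussian mixture** when it is a Gaussian (Bernstein–Widder / Schoenberg) mixture
`V(r) = ∫_0^∞ e^{-t r²} w(t) dt` of an absolutely continuous signed density `w` that changes sign
exactly once, from non-positive to non-negative: `w ≤ 0` on `(0, t₀)` (the slowly decaying
Gaussians `e^{-t r²}`, `t` small, enter with a minus sign: attraction at long range) and `w ≥ 0` on
`[t₀, ∞)` (repulsion at short range), for some `t₀ > 0`. For `w ≥ 0` throughout these are exactly
the completely monotone functions of `r²` (Schoenberg 1938, via the Hausdorff–Bernstein–Widder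
theorem); Bétermin–Petrache (2019) study lattice energies for potentials `f(|x|²)` with
`f(r) = ∫_0^∞ e^{-rt} dμ_f(t)` and `μ_f` negative on an initial interval `(0, r₀)` (op. cit. §1,
Thm. 1.5) — the present class is the absolutely continuous, one-sign-change case of that
representation (`f(s) = V(√s)`, `μ_f = w dt`).

## Contents

* `IsOneCrossingMixture V` — the predicate (definition; token-for-token the first conjunct of the
  inline hypothesis of the route items, so that the planned restatement is definitional:
  `isOneCrossingMixture_iff`).
* `integrableOn_exp_neg_mul_mul_pow`, `integral_exp_neg_mul_mul_pow` — `∫_0^∞ e^{-tb} tⁿ dt = n!/bⁿ⁺¹`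
  (from Mathlib's `Real.integral_rpow_mul_exp_neg_mul_Ioi`, `integrableOn_rpow_mul_exp_neg_mul_rpow`).
* `lennardJonesDensity t = t⁵/1440 - t²/12`, its sign (`lennardJonesDensity_nonpos/_nonneg`,
  crossing at `t₀ = 120^{1/3}`), and **`isOneCrossingMixture_lennardJones`**: the tree's
  Lennard-Jones potential `lennardJones r = r⁻¹²/12 - r⁻⁶/6` (`Crystallization.lean`, Blanc–Lewin's
  normalisation) is a one-crossing Gaussian mixture, since `∫_0^∞ e^{-tr²} t⁵ dt = 120 r⁻¹²` and
  `∫_0^∞ e^{-tr²} t² dt = 2 r⁻⁶`.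

Everything here is proved; no named facts. Mathlib has `Real.Gamma`, the Gamma integrals and
Gaussian integrability used above, but no Bernstein–Widder theory and no notion of sign changes of a
Laplace density (grep `completely monotone`, `Bernstein` in Mathlib: nothing relevant).

## References

* I. J. Schoenberg, *Metric spaces and completely monotone functions*, Ann. of Math. 39 (1938);
  *Metric spaces and positive definite functions*, Trans. AMS 44 (1938) 522–536. [Schoenberg1938]
* L. Bétermin, M. Petrache, *Optimal and non-optimal lattices for non-completely monotone
  interaction potentials*, Anal. Math. Phys. 9 (2019) 2033–2073, §1 (Laplace representation
  `f(r) = ∫ e^{-rt} dμ_f(t)`), Thm. 1.5. [BeterminPetrache2019]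
* G. Pólya, G. Szegő, *Aufgaben und Lehrsätze aus der Analysis II* (1925), Part V (sign changes of
  Laplace transforms). [PolyaSzego1925]
* X. Blanc, M. Lewin, *The crystallization conjecture: a review*, EMS Surv. 2 (2015), (3).
  [BlancLewin2015]
-/

noncomputable section

open MeasureTheory Set Real
open scoped Nat

namespace Literature.MathematicalPhysics.StatisticalMechanics

/-! ### The predicate -/

/-- **One-crossing Gaussian mixture** ("class 1" pair potential of route `OneSignChangeClass`):
`V : ℝ → ℝ` (a function of the distance `r > 0`) admits a density `w : ℝ → ℝ` and a crossing
point `t₀ > 0` with `w ≤ 0` on `(0, t₀)`, `w ≥ 0` on `[t₀, ∞)`, and for every `r > 0` the function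
`t ↦ e^{-t r²} w(t)` is integrable on `(0, ∞)` with `V(r) = ∫_0^∞ e^{-t r²} w(t) dt`. One sign
change of the Bernstein–Widder density: the Gaussian-mixture representation of completely monotone
functions of `r²` (Schoenberg 1938) with the density allowed to be negative on an initial interval,
as in Bétermin–Petrache 2019, §1 and Thm. 1.5 (`f(r) = ∫_0^∞ e^{-rt} dμ_f(t)`, `μ_f < 0` on
`(0, r₀)`; here `f(s) = V(√s)`, `dμ_f = w dt`, and additionally `w ≥ 0` beyond the crossing).
Token-for-token the first conjunct of the inline class-1 hypothesis of items
stmt-AtomisticToContinuum-4041 – 4047. [cite: BeterminPetrache2019, §1 and Thm. 1.5] -/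
def IsOneCrossingMixture (V : ℝ → ℝ) : Prop :=
  ∃ (w : ℝ → ℝ) (t₀ : ℝ), 0 < t₀ ∧ (∀ t ∈ Set.Ioo 0 t₀, w t ≤ 0) ∧ (∀ t, t₀ ≤ t → 0 ≤ w t) ∧
    ∀ r : ℝ, 0 < r →
      MeasureTheory.IntegrableOn (fun t => Real.exp (-(t * r ^ 2)) * w t) (Set.Ioi 0) ∧
        V r = ∫ t in Set.Ioi 0, Real.exp (-(t * r ^ 2)) * w t

/-- Unfolding of `IsOneCrossingMixture` (definitional; this is the form carried inline by the
route items). [folklore] -/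
theorem isOneCrossingMixture_iff (V : ℝ → ℝ) :
    IsOneCrossingMixture V ↔
      ∃ (w : ℝ → ℝ) (t₀ : ℝ), 0 < t₀ ∧ (∀ t ∈ Set.Ioo 0 t₀, w t ≤ 0) ∧ (∀ t, t₀ ≤ t → 0 ≤ w t) ∧
        ∀ r : ℝ, 0 < r →
          MeasureTheory.IntegrableOn (fun t => Real.exp (-(t * r ^ 2)) * w t) (Set.Ioi 0) ∧
            V r = ∫ t in Set.Ioi 0, Real.exp (-(t * r ^ 2)) * w t :=
  Iff.rfl

/-- A one-crossing Gaussian mixture is determined on `r > 0` by its density: the representation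
clause, projected. [folklore] -/
theorem IsOneCrossingMixture.exists_eq_integral {V : ℝ → ℝ} (h : IsOneCrossingMixture V) :
    ∃ w : ℝ → ℝ, ∀ r : ℝ, 0 < r → V r = ∫ t in Set.Ioi 0, Real.exp (-(t * r ^ 2)) * w t := by
  obtain ⟨w, t₀, -, -, -, hw⟩ := h
  exact ⟨w, fun r hr => (hw r hr).2⟩

/-! ### Gamma integrals `∫_0^∞ e^{-tb} tⁿ dt = n! / bⁿ⁺¹` -/

/-- For `b > 0` and `n : ℕ`, `t ↦ e^{-tb} tⁿ` is integrable on `(0, ∞)` (Mathlib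
`integrableOn_rpow_mul_exp_neg_mul_rpow` with `p = 1`). [folklore] -/
theorem integrableOn_exp_neg_mul_mul_pow (n : ℕ) {b : ℝ} (hb : 0 < b) :
    IntegrableOn (fun t : ℝ => Real.exp (-(t * b)) * t ^ n) (Ioi 0) := by
  have hs : (-1 : ℝ) < n := by
    have := n.cast_nonneg (α := ℝ)
    linarith
  have h := integrableOn_rpow_mul_exp_neg_mul_rpow (s := (n : ℝ)) (p := 1) hs le_rfl hb
  refine h.congr_fun (fun t _ => ?_) measurableSet_Ioi
  dsimp only
  rw [Real.rpow_natCast, Real.rpow_one, mul_comm, show -b * t = -(t * b) by ring]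

/-- **Euler's integral**: for `b > 0` and `n : ℕ`, `∫_0^∞ e^{-tb} tⁿ dt = n! / bⁿ⁺¹` (Mathlib
`Real.integral_rpow_mul_exp_neg_mul_Ioi`, `Real.Gamma_nat_eq_factorial`). [folklore] -/
theorem integral_exp_neg_mul_mul_pow (n : ℕ) {b : ℝ} (hb : 0 < b) :
    ∫ t in Ioi (0 : ℝ), Real.exp (-(t * b)) * t ^ n = n ! / b ^ (n + 1) := by
  have h := Real.integral_rpow_mul_exp_neg_mul_Ioi (a := (n : ℝ) + 1) (r := b) (by positivity) hb
  rw [add_sub_cancel_right, Real.Gamma_nat_eq_factorial] at h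
  calc ∫ t in Ioi (0 : ℝ), Real.exp (-(t * b)) * t ^ n
      = ∫ t in Ioi (0 : ℝ), t ^ (n : ℝ) * Real.exp (-(b * t)) := by
        refine setIntegral_congr_fun measurableSet_Ioi (fun t _ => ?_)
        rw [Real.rpow_natCast, mul_comm t b, mul_comm]
    _ = (1 / b) ^ ((n : ℝ) + 1) * n ! := h
    _ = n ! / b ^ (n + 1) := by
        rw [show ((n : ℝ) + 1) = ((n + 1 : ℕ) : ℝ) by push_cast; ring, Real.rpow_natCast,
          one_div_pow]
        ring

/-! ### The Lennard-Jones density -/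

/-- The **Gaussian-mixture density of the Lennard-Jones potential** `r⁻¹²/12 - r⁻⁶/6`:
`w(t) = t⁵/1440 - t²/12`, so that `∫_0^∞ e^{-tr²} w(t) dt = (120/1440) r⁻¹² - (2/12) r⁻⁶`
(`isOneCrossingMixture_lennardJones`). [folklore] -/
def lennardJonesDensity (t : ℝ) : ℝ :=
  t ^ 5 / 1440 - t ^ 2 / 12

/-- Factorised form `w(t) = t² (t³ - 120) / 1440`: one sign change, at `t₀ = 120^{1/3}`.
[folklore] -/
theorem lennardJonesDensity_eq (t : ℝ) :
    lennardJonesDensity t = t ^ 2 * (t ^ 3 - 120) / 1440 := by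
  unfold lennardJonesDensity
  ring

/-- `(120^{1/3})³ = 120`. [folklore] -/
theorem rpow_oneThird_pow_three : ((120 : ℝ) ^ (1 / 3 : ℝ)) ^ 3 = 120 := by
  rw [← Real.rpow_natCast, ← Real.rpow_mul (by norm_num)]
  norm_num

/-- Below the crossing the Lennard-Jones density is non-positive: `w(t) ≤ 0` for
`0 < t < 120^{1/3}` (indeed for `0 ≤ t ≤ 120^{1/3}`). [folklore] -/
theorem lennardJonesDensity_nonpos {t : ℝ} (ht0 : 0 < t) (ht : t < (120 : ℝ) ^ (1 / 3 : ℝ)) :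
    lennardJonesDensity t ≤ 0 := by
  rw [lennardJonesDensity_eq]
  have h3 : t ^ 3 < 120 := by
    calc t ^ 3 < ((120 : ℝ) ^ (1 / 3 : ℝ)) ^ 3 := pow_lt_pow_left₀ ht ht0.le (by norm_num)
      _ = 120 := rpow_oneThird_pow_three
  have h : t ^ 2 * (t ^ 3 - 120) ≤ 0 :=
    mul_nonpos_iff.mpr (Or.inl ⟨sq_nonneg t, by linarith⟩)
  exact div_nonpos_iff.mpr (Or.inr ⟨h, by norm_num⟩)

/-- Above the crossing the Lennard-Jones density is non-negative: `w(t) ≥ 0` for `t ≥ 120^{1/3}`.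
[folklore] -/
theorem lennardJonesDensity_nonneg {t : ℝ} (ht : (120 : ℝ) ^ (1 / 3 : ℝ) ≤ t) :
    0 ≤ lennardJonesDensity t := by
  rw [lennardJonesDensity_eq]
  have h3 : 120 ≤ t ^ 3 := by
    calc (120 : ℝ) = ((120 : ℝ) ^ (1 / 3 : ℝ)) ^ 3 := rpow_oneThird_pow_three.symm
      _ ≤ t ^ 3 := pow_le_pow_left₀ (Real.rpow_nonneg (by norm_num) _) ht 3
  have h : 0 ≤ t ^ 2 * (t ^ 3 - 120) := mul_nonneg (sq_nonneg t) (by linarith)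
  exact div_nonneg h (by norm_num)

/-- **Lennard-Jones is a one-crossing Gaussian mixture** (support item `LennardJonesClassOne` of
route `OneSignChangeClass`, first conjunct): with `w(t) = t⁵/1440 - t²/12` and `t₀ = 120^{1/3}`,
`w ≤ 0` on `(0, t₀)`, `w ≥ 0` on `[t₀, ∞)`, `t ↦ e^{-tr²} w(t)` is integrable on `(0, ∞)` for
`r > 0`, and `∫_0^∞ e^{-tr²} w(t) dt = 120 r⁻¹²/1440 - 2 r⁻⁶/12 = r⁻¹²/12 - r⁻⁶/6 = lennardJones r`
(Euler's integral `∫_0^∞ e^{-tb} tⁿ dt = n!/bⁿ⁺¹` with `b = r²`). The difference-of-completely-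
monotone structure of Lennard-Jones type potentials is Bétermin–Petrache 2019, §1.
[cite: BeterminPetrache2019, §1] -/
theorem isOneCrossingMixture_lennardJones : IsOneCrossingMixture lennardJones := by
  refine ⟨lennardJonesDensity, (120 : ℝ) ^ (1 / 3 : ℝ), by positivity,
    fun t ht => lennardJonesDensity_nonpos ht.1 ht.2, fun t ht => lennardJonesDensity_nonneg ht,
    fun r hr => ?_⟩
  have hb : 0 < r ^ 2 := by positivity
  have hi5 : Integrable (fun t : ℝ => Real.exp (-(t * r ^ 2)) * t ^ 5) (volume.restrict (Ioi 0)) :=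
    integrableOn_exp_neg_mul_mul_pow 5 hb
  have hi2 : Integrable (fun t : ℝ => Real.exp (-(t * r ^ 2)) * t ^ 2) (volume.restrict (Ioi 0)) :=
    integrableOn_exp_neg_mul_mul_pow 2 hb
  have e : ∀ t : ℝ, Real.exp (-(t * r ^ 2)) * lennardJonesDensity t =
      Real.exp (-(t * r ^ 2)) * t ^ 5 / 1440 - Real.exp (-(t * r ^ 2)) * t ^ 2 / 12 := fun t => by
    unfold lennardJonesDensity
    ring
  have hint : IntegrableOn (fun t => Real.exp (-(t * r ^ 2)) * lennardJonesDensity t) (Ioi 0) := by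
    have := (hi5.div_const 1440).sub (hi2.div_const 12)
    refine (this.congr ?_)
    exact Filter.Eventually.of_forall fun t => (e t).symm
  refine ⟨hint, ?_⟩
  simp_rw [e]
  rw [integral_sub (hi5.div_const 1440) (hi2.div_const 12), integral_div, integral_div,
    integral_exp_neg_mul_mul_pow 5 hb, integral_exp_neg_mul_mul_pow 2 hb]
  unfold lennardJones
  have hr0 : r ≠ 0 := hr.ne'
  simp only [Nat.factorial, Nat.succ_eq_add_one, Nat.cast_mul, Nat.cast_one]
  field_simp
  ring

end Literature.MathematicalPhysics.StatisticalMechanics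

end
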